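import Summits.Parity.GeneralizedHardyLittlewood.Theorems.LiouvilleShiftedTablesDefs
import Literature.NumberTheory.Sieve.DrappeauDispersionLemmas
import Literature.NumberTheory.Sieve.DivisorPowerSums

/-!
# The `𝔲_R` terms of the assembly (`stub_uRBound`), file 1: the norm functional `NS(a)` and its trivial bound

Route `LiouvilleShiftedTables` (Parity / GeneralizedHardyLittlewood), crux `TypeI2Dilated` (stmt-Parity-14272), line
`peel-to-drappeau`, registered stub `stub_uRBound : URBound` (vocabulary in `…LiouvilleShiftedTablesDefs`: `sRange`,
`classFilter`, `uRPiece`, `URBound`).  The left side of `URBound` is `NS(λ)` for the functional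

`NS(a) := ∑_{q ≤ x^ρ} ∑_{r ≤ R} ‖∑_{s ∈ sRange c q (rP) Slo (2Slo)} ∑_{m ∈ classFilter c q w (rP) Y} a(m) 𝔲_{x^{40ρ}}(m c̄; s)‖`

of a real sequence `a` (`normSum`).  This file records its formal properties — it only sees `a` on `[1, Y]`, it is
absolutely homogeneous and subadditive (`normSum_congr`, `normSum_smul`, `normSum_add_le`, `normSum_sum_le`) — and the
TRIVIAL BOUND (Step T of the stub's proof): by Drappeau's (5.2), `|𝔲_{Rd}(t; s)| ≤ 1_{t = 1} + Rd τ(s)/φ(s)`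
(`Drappeau2017.norm_uR_le`), so that

`NS(a) ≤ ⌊x^ρ⌋ ⌊R⌋ ∑_{1 ≤ m ≤ Y} |a(m)| (#{s ≤ 2Slo : s ∣ m − c} + Rd Ψ₁)`, `Ψ₁ = ∑_{s ≤ 2Slo} τ(s)/φ(s)`

(`normSum_le_trivial`), and, splitting off `m = c` and bounding the divisor count by `D`,
`NS(a) ≤ ⌊x^ρ⌋ ⌊R⌋ ((D + Rd Ψ₁) ∑_{m ≤ Y} |a(m)| + 2 Slo ∑_{m ≤ Y, m = c} |a(m)|)` (`normSum_le_trivial'`).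
[this line: Lines/peel-to-drappeau.md; cite: Drappeau2017, §5 (5.2)]
-/

noncomputable section

namespace Summit.Parity.GeneralizedHardyLittlewood.Cruxes.TypeI2Dilated.PeelToDrappeau

open Finset Real
open scoped ArithmeticFunction.sigma Classical
open Literature.NumberTheory.Sieve Literature.NumberTheory.Sieve.Drappeau2017

/-! ### The norm functional -/

/-- `NS(a)`: the `(q, r)` double sum of norms of the `𝔲_R`-pieces with `λ` replaced by a real sequence `a`
(so that the left side of `URBound` is `NS(λ)`), conductor cut `Rd = x^{40ρ}`. [this line] -/
def normSum (c : ℤ) (w P : ℕ) (x ρ Y R Slo : ℝ) (a : ℕ → ℝ) : ℝ :=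
  ∑ q ∈ Icc 1 ⌊x ^ ρ⌋₊, ∑ r ∈ Icc 1 ⌊R⌋₊,
    ‖∑ s ∈ sRange c q (r * P) Slo (2 * Slo), ∑ m ∈ classFilter c q w (r * P) Y,
        ((a m : ℝ) : ℂ) * uR (x ^ (40 * ρ)) s ((m : ZMod s) * ((c : ZMod s))⁻¹)‖

/-- The left side of `URBound` is `NS(λ)`. [this line] -/
theorem lhs_eq_normSum (c : ℤ) (w P : ℕ) (x ρ Y R Slo : ℝ) :
    (∑ q ∈ Icc 1 ⌊x ^ ρ⌋₊, ∑ r ∈ Icc 1 ⌊R⌋₊,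
      ‖∑ s ∈ sRange c q (r * P) Slo (2 * Slo), uRPiece c q w (r * P) s Y (x ^ (40 * ρ))‖) =
      normSum c w P x ρ Y R Slo (fun m => (ArithmeticFunction.liouville m : ℝ)) := by
  unfold normSum uRPiece
  simp only [Complex.ofReal_intCast]

/-- `NS(a) ≥ 0`. [this line] -/
theorem normSum_nonneg (c : ℤ) (w P : ℕ) (x ρ Y R Slo : ℝ) (a : ℕ → ℝ) : 0 ≤ normSum c w P x ρ Y R Slo a :=
  Finset.sum_nonneg fun _ _ => Finset.sum_nonneg fun _ _ => norm_nonneg _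

/-- The class filter lives in `[1, Y]`. [this line] -/
theorem classFilter_subset (c : ℤ) (q w r : ℕ) (Y : ℝ) : classFilter c q w r Y ⊆ Icc 1 ⌊Y⌋₊ :=
  Finset.filter_subset _ _

/-- `NS(a)` depends only on `a|[1, Y]`. [this line] -/
theorem normSum_congr (c : ℤ) (w P : ℕ) (x ρ Y R Slo : ℝ) {a b : ℕ → ℝ}
    (h : ∀ m ∈ Icc 1 ⌊Y⌋₊, a m = b m) : normSum c w P x ρ Y R Slo a = normSum c w P x ρ Y R Slo b := by
  unfold normSum
  refine Finset.sum_congr rfl fun q _ => Finset.sum_congr rfl fun r _ => ?_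
  congr 1
  refine Finset.sum_congr rfl fun s _ => Finset.sum_congr rfl fun m hm => ?_
  rw [h m (classFilter_subset c q w (r * P) Y hm)]

/-- `NS` vanishes on sequences vanishing on `[1, Y]`. [this line] -/
theorem normSum_eq_zero_of (c : ℤ) (w P : ℕ) (x ρ Y R Slo : ℝ) {a : ℕ → ℝ}
    (h : ∀ m ∈ Icc 1 ⌊Y⌋₊, a m = 0) : normSum c w P x ρ Y R Slo a = 0 := by
  unfold normSum
  refine Finset.sum_eq_zero fun q _ => Finset.sum_eq_zero fun r _ => ?_
  rw [Finset.sum_eq_zero fun s _ => Finset.sum_eq_zero fun m hm => by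
    rw [h m (classFilter_subset c q w (r * P) Y hm), Complex.ofReal_zero, zero_mul], norm_zero]

/-- Absolute homogeneity: `NS(t a) = |t| NS(a)`. [this line] -/
theorem normSum_smul (c : ℤ) (w P : ℕ) (x ρ Y R Slo : ℝ) (t : ℝ) (a : ℕ → ℝ) :
    normSum c w P x ρ Y R Slo (fun m => t * a m) = |t| * normSum c w P x ρ Y R Slo a := by
  unfold normSum
  rw [Finset.mul_sum]
  refine Finset.sum_congr rfl fun q _ => ?_
  rw [Finset.mul_sum]
  refine Finset.sum_congr rfl fun r _ => ?_
  rw [← Real.norm_eq_abs, ← Complex.norm_real, ← norm_mul, Finset.mul_sum]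
  congr 1
  refine Finset.sum_congr rfl fun s _ => ?_
  rw [Finset.mul_sum]
  refine Finset.sum_congr rfl fun m _ => ?_
  push_cast
  ring

/-- Subadditivity: `NS(a + b) ≤ NS(a) + NS(b)`. [this line] -/
theorem normSum_add_le (c : ℤ) (w P : ℕ) (x ρ Y R Slo : ℝ) (a b : ℕ → ℝ) :
    normSum c w P x ρ Y R Slo (fun m => a m + b m) ≤ normSum c w P x ρ Y R Slo a + normSum c w P x ρ Y R Slo b := by
  unfold normSum
  rw [← Finset.sum_add_distrib]
  refine Finset.sum_le_sum fun q _ => ?_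
  rw [← Finset.sum_add_distrib]
  refine Finset.sum_le_sum fun r _ => ?_
  refine le_trans (le_of_eq ?_) (norm_add_le _ _)
  rw [← Finset.sum_add_distrib]
  congr 1
  refine Finset.sum_congr rfl fun s _ => ?_
  rw [← Finset.sum_add_distrib]
  refine Finset.sum_congr rfl fun m _ => ?_
  push_cast
  ring

/-- Subadditivity over a finite family: `NS(∑_j a_j) ≤ ∑_j NS(a_j)`. [this line] -/
theorem normSum_sum_le {ι : Type*} (J : Finset ι) (c : ℤ) (w P : ℕ) (x ρ Y R Slo : ℝ) (a : ι → ℕ → ℝ) :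
    normSum c w P x ρ Y R Slo (fun m => ∑ j ∈ J, a j m) ≤ ∑ j ∈ J, normSum c w P x ρ Y R Slo (a j) := by
  induction J using Finset.induction_on with
  | empty =>
      simp only [Finset.sum_empty]
      exact le_of_eq (normSum_eq_zero_of c w P x ρ Y R Slo fun _ _ => rfl)
  | @insert j J hj ih =>
      rw [Finset.sum_insert hj]
      have h1 : normSum c w P x ρ Y R Slo (fun m => ∑ i ∈ insert j J, a i m) =
          normSum c w P x ρ Y R Slo (fun m => a j m + ∑ i ∈ J, a i m) :=
        normSum_congr c w P x ρ Y R Slo fun m _ => Finset.sum_insert hj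
      rw [h1]
      exact (normSum_add_le c w P x ρ Y R Slo _ _).trans (add_le_add le_rfl ih)

/-- A weighted version: `NS(∑_j t_j a_j) ≤ ∑_j |t_j| NS(a_j)`. [this line] -/
theorem normSum_sum_smul_le {ι : Type*} (J : Finset ι) (c : ℤ) (w P : ℕ) (x ρ Y R Slo : ℝ) (t : ι → ℝ)
    (a : ι → ℕ → ℝ) :
    normSum c w P x ρ Y R Slo (fun m => ∑ j ∈ J, t j * a j m) ≤ ∑ j ∈ J, |t j| * normSum c w P x ρ Y R Slo (a j) := by
  refine (normSum_sum_le J c w P x ρ Y R Slo (fun j m => t j * a j m)).trans (le_of_eq ?_)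
  exact Finset.sum_congr rfl fun j _ => normSum_smul c w P x ρ Y R Slo (t j) (a j)

/-! ### Step T: the trivial bound -/

/-- Membership in `sRange`. [this line] -/
theorem mem_sRange {c : ℤ} {q r : ℕ} {Slo S : ℝ} {s : ℕ} :
    s ∈ sRange c q r Slo S ↔ (1 ≤ s ∧ s ≤ ⌊S⌋₊) ∧ Slo < (s : ℝ) ∧ s.Coprime (q * r) ∧ IsCoprime (s : ℤ) c := by
  unfold sRange
  rw [Finset.mem_filter, Finset.mem_Icc]

/-- `sRange c q r Slo S ⊆ [1, S]`. [this line] -/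
theorem sRange_subset (c : ℤ) (q r : ℕ) (Slo S : ℝ) : sRange c q r Slo S ⊆ Icc 1 ⌊S⌋₊ :=
  Finset.filter_subset _ _

/-- The divisor count of Step T: `#{1 ≤ s ≤ S : s ∣ m − c}`. [this line] -/
def divCount (c : ℤ) (S : ℝ) (m : ℕ) : ℕ :=
  ((Icc 1 ⌊S⌋₊).filter (fun s : ℕ => (s : ℤ) ∣ (m : ℤ) - c)).card

/-- `Ψ₁(S) = ∑_{s ≤ S} τ(s)/φ(s)`. [this line] -/
def psiOne (S : ℝ) : ℝ :=
  ∑ s ∈ Icc 1 ⌊S⌋₊, (σ 0 s : ℝ) / (Nat.totient s : ℝ)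

/-- `Ψ₁ ≥ 0`. [this line] -/
theorem psiOne_nonneg (S : ℝ) : 0 ≤ psiOne S :=
  Finset.sum_nonneg fun _ _ => by positivity

/-- **Drappeau's (5.2) summed over `sRange`**: for `Rd ≥ 0` and every `m`,
`∑_{s ∈ sRange c q r Slo S} |𝔲_{Rd}(m c̄; s)| ≤ #{s ≤ S : s ∣ m − c} + Rd Ψ₁(S)`. [cite: Drappeau2017, §5 (5.2)] -/
theorem sum_sRange_norm_uR_le (c : ℤ) (q r : ℕ) (Slo S : ℝ) {Rd : ℝ} (hRd : 0 ≤ Rd) (m : ℕ) :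
    ∑ s ∈ sRange c q r Slo S, ‖uR Rd s ((m : ZMod s) * ((c : ZMod s))⁻¹)‖ ≤
      (divCount c S m : ℝ) + Rd * psiOne S := by
  have hterm : ∀ s ∈ sRange c q r Slo S, ‖uR Rd s ((m : ZMod s) * ((c : ZMod s))⁻¹)‖ ≤
      (if (s : ℤ) ∣ (m : ℤ) - c then (1 : ℝ) else 0) + Rd * ((σ 0 s : ℝ) / (Nat.totient s : ℝ)) := by
    intro s hs
    obtain ⟨⟨hs1, -⟩, -, -, hsc⟩ := mem_sRange.1 hs
    haveI : NeZero s := ⟨by omega⟩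
    refine (norm_uR_le hs1 hRd _).trans (add_le_add ?_ (le_of_eq (by ring)))
    by_cases h1 : (m : ZMod s) * ((c : ZMod s))⁻¹ = 1
    · rw [if_pos h1, if_pos]
      have hcu : IsUnit (c : ZMod s) := (ZMod.coe_int_isUnit_iff_isCoprime c s).2 hsc
      have hN : ((m : ℤ) : ZMod s) = (c : ZMod s) := by
        calc ((m : ℤ) : ZMod s) = ((m : ZMod s) * ((c : ZMod s))⁻¹) * (c : ZMod s) := by
              rw [mul_assoc, ZMod.inv_mul_of_unit _ hcu, mul_one, Int.cast_natCast]
          _ = (c : ZMod s) := by rw [h1, one_mul]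
      rw [← ZMod.intCast_zmod_eq_zero_iff_dvd, Int.cast_sub, hN, sub_self]
    · rw [if_neg h1]
      split_ifs
      · exact zero_le_one
      · exact le_rfl
  refine (Finset.sum_le_sum hterm).trans ?_
  rw [Finset.sum_add_distrib, ← Finset.mul_sum, Finset.sum_boole]
  refine add_le_add ?_ (mul_le_mul_of_nonneg_left ?_ hRd)
  · unfold divCount
    exact_mod_cast Finset.card_le_card (Finset.filter_subset_filter _ (sRange_subset c q r Slo S))
  · unfold psiOne
    exact Finset.sum_le_sum_of_subset_of_nonneg (sRange_subset c q r Slo S) fun _ _ _ => by positivity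

/-- One `(q, r)` term of `NS(a)`, trivially: `‖∑_s ∑_m a(m) 𝔲‖ ≤ ∑_{m ≤ Y} |a(m)| (divCount(m) + Rd Ψ₁)`. [this line] -/
theorem norm_term_le_trivial (c : ℤ) (q w r : ℕ) (Y Slo : ℝ) {Rd : ℝ} (hRd : 0 ≤ Rd) (a : ℕ → ℝ) :
    ‖∑ s ∈ sRange c q r Slo (2 * Slo), ∑ m ∈ classFilter c q w r Y,
        ((a m : ℝ) : ℂ) * uR Rd s ((m : ZMod s) * ((c : ZMod s))⁻¹)‖ ≤
      ∑ m ∈ Icc 1 ⌊Y⌋₊, |a m| * ((divCount c (2 * Slo) m : ℝ) + Rd * psiOne (2 * Slo)) := by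
  rw [Finset.sum_comm]
  refine (norm_sum_le _ _).trans ?_
  calc ∑ m ∈ classFilter c q w r Y, ‖∑ s ∈ sRange c q r Slo (2 * Slo),
        ((a m : ℝ) : ℂ) * uR Rd s ((m : ZMod s) * ((c : ZMod s))⁻¹)‖
      ≤ ∑ m ∈ classFilter c q w r Y, |a m| * ((divCount c (2 * Slo) m : ℝ) + Rd * psiOne (2 * Slo)) := by
        refine Finset.sum_le_sum fun m _ => (norm_sum_le _ _).trans ?_
        simp only [norm_mul, Complex.norm_real, Real.norm_eq_abs, ← Finset.mul_sum]
        exact mul_le_mul_of_nonneg_left (sum_sRange_norm_uR_le c q r Slo (2 * Slo) hRd m) (abs_nonneg _)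
    _ ≤ _ := Finset.sum_le_sum_of_subset_of_nonneg (classFilter_subset c q w r Y) fun m _ _ => by
        have := psiOne_nonneg (2 * Slo)
        positivity

/-- **Step T — the trivial bound for `NS(a)`**:
`NS(a) ≤ ⌊x^ρ⌋ ⌊R⌋ ∑_{1 ≤ m ≤ Y} |a(m)| (#{s ≤ 2Slo : s ∣ m − c} + x^{40ρ} Ψ₁(2Slo))`. [this line] -/
theorem normSum_le_trivial (c : ℤ) (w P : ℕ) {x : ℝ} (hx : 0 ≤ x) (ρ Y R Slo : ℝ) (a : ℕ → ℝ) :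
    normSum c w P x ρ Y R Slo a ≤ (⌊x ^ ρ⌋₊ : ℝ) * (⌊R⌋₊ : ℝ) *
      ∑ m ∈ Icc 1 ⌊Y⌋₊, |a m| * ((divCount c (2 * Slo) m : ℝ) + x ^ (40 * ρ) * psiOne (2 * Slo)) := by
  have hRd : 0 ≤ x ^ (40 * ρ) := Real.rpow_nonneg hx _
  unfold normSum
  calc _ ≤ ∑ _q ∈ Icc 1 ⌊x ^ ρ⌋₊, ∑ _r ∈ Icc 1 ⌊R⌋₊,
        ∑ m ∈ Icc 1 ⌊Y⌋₊, |a m| * ((divCount c (2 * Slo) m : ℝ) + x ^ (40 * ρ) * psiOne (2 * Slo)) :=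
        Finset.sum_le_sum fun q _ => Finset.sum_le_sum fun r _ => norm_term_le_trivial c q w (r * P) Y Slo hRd a
    _ = _ := by
        rw [Finset.sum_const, Finset.sum_const, Nat.card_Icc, Nat.card_Icc, smul_smul, nsmul_eq_mul]
        push_cast
        ring

/-- The divisor count is at most `τ(|m − c|)` for `m ≠ c`. [folklore] -/
theorem divCount_le_sigma {c : ℤ} {m : ℕ} (hm : (m : ℤ) ≠ c) (S : ℝ) :
    divCount c S m ≤ σ 0 (((m : ℤ) - c).natAbs) := by
  unfold divCount
  rw [ArithmeticFunction.sigma_zero_apply]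
  refine Finset.card_le_card fun s hs => ?_
  rw [Finset.mem_filter] at hs
  rw [Nat.mem_divisors]
  exact ⟨Int.natCast_dvd.1 hs.2, Int.natAbs_ne_zero.2 (sub_ne_zero.2 hm)⟩

/-- The divisor count is at most `S` always. [folklore] -/
theorem divCount_le (c : ℤ) {S : ℝ} (hS : 0 ≤ S) (m : ℕ) : (divCount c S m : ℝ) ≤ S := by
  unfold divCount
  calc (((Icc 1 ⌊S⌋₊).filter (fun s : ℕ => (s : ℤ) ∣ (m : ℤ) - c)).card : ℝ) ≤ ((Icc 1 ⌊S⌋₊).card : ℝ) := by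
        exact_mod_cast Finset.card_filter_le _ _
    _ = ⌊S⌋₊ := by rw [Nat.card_Icc]; push_cast; ring
    _ ≤ S := Nat.floor_le hS

/-- **Step T with the `m = c` term split off**: if `τ(|m − c|) ≤ D` for all `1 ≤ m ≤ Y`, `m ≠ c`, then
`NS(a) ≤ ⌊x^ρ⌋ ⌊R⌋ ((D + x^{40ρ} Ψ₁) ∑_{m ≤ Y} |a(m)| + 2Slo ∑_{m ≤ Y, m = c} |a(m)|)`. [this line] -/
theorem normSum_le_trivial' (c : ℤ) (w P : ℕ) {x : ℝ} (hx : 0 ≤ x) (ρ Y R : ℝ) {Slo : ℝ} (hSlo : 0 ≤ Slo)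
    (a : ℕ → ℝ) {D : ℝ} (hD0 : 0 ≤ D)
    (hD : ∀ m ∈ Icc 1 ⌊Y⌋₊, (m : ℤ) ≠ c → (σ 0 (((m : ℤ) - c).natAbs) : ℝ) ≤ D) :
    normSum c w P x ρ Y R Slo a ≤ (⌊x ^ ρ⌋₊ : ℝ) * (⌊R⌋₊ : ℝ) *
      ((D + x ^ (40 * ρ) * psiOne (2 * Slo)) * ∑ m ∈ Icc 1 ⌊Y⌋₊, |a m| +
        2 * Slo * ∑ m ∈ (Icc 1 ⌊Y⌋₊).filter (fun m : ℕ => (m : ℤ) = c), |a m|) := by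
  refine (normSum_le_trivial c w P hx ρ Y R Slo a).trans (mul_le_mul_of_nonneg_left ?_ (by positivity))
  have hΨ := psiOne_nonneg (2 * Slo)
  have hRd : 0 ≤ x ^ (40 * ρ) := Real.rpow_nonneg hx _
  rw [Finset.mul_sum, Finset.mul_sum, Finset.sum_filter, ← Finset.sum_add_distrib]
  refine Finset.sum_le_sum fun m hm => ?_
  by_cases hmc : (m : ℤ) = c
  · rw [if_pos hmc]
    have h1 : (divCount c (2 * Slo) m : ℝ) ≤ 2 * Slo := divCount_le c (by linarith) m
    nlinarith [abs_nonneg (a m)]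
  · rw [if_neg hmc, add_zero]
    have h1 : (divCount c (2 * Slo) m : ℝ) ≤ D :=
      le_trans (by exact_mod_cast divCount_le_sigma hmc (2 * Slo)) (hD m hm hmc)
    nlinarith [abs_nonneg (a m)]

/-- Landing anchor of the `𝔲_R`-bound chain, file 1; registered stub `urbChain1_anchor` of the crux item (the
mathematical content of this file is `normSum_le_trivial'`). -/
theorem urbChain1_anchor : True := trivial

end Summit.Parity.GeneralizedHardyLittlewood.Cruxes.TypeI2Dilated.PeelToDrappeau

end
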